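import Summits.CriticalPhenomena.PercolationContinuityZ3.Theorems.Transplant.HexShadowVRouteData
import HarnessLib

/-!
# HEXAGONAL SHADOWS L — `LocalLinkage` implies `ShapedLinkage 3` (the shaped node generalises the gen-33 node)

builds on p205010 (kernel theorem, internal audit signed; external expert review pending) — NOT used in this file.  Lane `prim-bschramm`, seat
`prim-bschramm-p2` (gen 34; class C1b; memo `HOME/bschramm/P2-LATTICES.md` §125); helper file (`--supports stmt-CriticalPhenomena-4575 --as helper`).
Consistency check for the new instance node of «HexShadowVRouteData»: with the FULL lifted block as cleared vertex set, the certified terminal data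
`HexShadow.Terminals 3` implies the hypotheses of `HexShadow.LocalLinkage` (the outer neighbour `o₁ ∉ W` of `E₁` lies over the window but outside
`hexBall z 3`, so `E₁` is over `hexSphere z 3`; likewise `E₂`), and column routing data is vertex routing data.  Hence every `LocalLinkage` instance
(e.g. `𝕋 × {0..k}`, `k ≥ 2`, «TriFilmLinkage») is a `ShapedLinkage 3` instance: **`shapedLinkage_of_localLinkage`**.
[cite: DuminilCopinSidoraviciusTassion2016, §2.3 (proof of Fact 2, p. 6: the choice of R)]
-/

noncomputable section

namespace Summit.CriticalPhenomena.PercolationContinuityZ3.Theorems.Transplant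

open MeasureTheory Literature.Probability.Percolation Literature.Probability.LatticeModels SimpleGraph Filter
open scoped Classical Topology

/-- The triangle inequality for `triNorm`, distance form (private copy). [folklore] -/
private theorem triNorm_sub_le₃₄ (u v w : Site 2) : triNorm (u - w) ≤ triNorm (u - v) + triNorm (v - w) := by
  simp only [triNorm, Pi.sub_apply, max_le_iff]
  have l0 := (abs_le_triNorm (u - v)).1; have l1 := (abs_le_triNorm (u - v)).2
  have l2 : |(u - v) 0 + (u - v) 1| ≤ triNorm (u - v) := (le_max_right _ _).trans (le_max_right _ _)
  have m0 := (abs_le_triNorm (v - w)).1; have m1 := (abs_le_triNorm (v - w)).2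
  have m2 : |(v - w) 0 + (v - w) 1| ≤ triNorm (v - w) := (le_max_right _ _).trans (le_max_right _ _)
  simp only [triNorm, Pi.sub_apply] at l0 l1 l2 m0 m1 m2 ⊢
  rw [abs_le] at l0 l1 l2 m0 m1 m2
  refine ⟨abs_le.2 ⟨?_, ?_⟩, abs_le.2 ⟨?_, ?_⟩, abs_le.2 ⟨?_, ?_⟩⟩ <;> linarith

namespace HexShadow

variable {V : Type} {G : SimpleGraph V} {Φ : HexShadow G}

/-- **Column routing data is vertex routing data** for the lifted blocks (`RP ⊆ D`). [folklore] -/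
def RouteData.toV {RP D : Set (Site 2)} {E₁ E₂ w' : V} (r : Φ.RouteData RP D E₁ E₂ w') (hRD : RP ⊆ D) :
    VRouteData G (Φ.lift D ∩ Φ.lift RP) (Φ.lift D) E₁ E₂ w' where
  P := r.P
  c := r.c
  y := r.y
  Br := r.Br
  hP := fun x hx => by
    refine ⟨?_, ?_⟩ <;> rw [mem_lift]
    · exact hRD (r.hP x hx)
    · exact r.hP x hx
  hchain := r.hchain
  hnodup := r.hnodup
  hy := r.hy
  hBr := r.hBr
  hBrW := fun x hx => by rw [mem_lift]; exact r.hBrD x hx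
  hBrchain := r.hBrchain
  hBrnodup := r.hBrnodup
  hBrSP := r.hBrSP
  hBrlast := r.hBrlast

/-- `toV` keeps `y`. [folklore] -/
@[simp] theorem RouteData.toV_y {RP D : Set (Site 2)} {E₁ E₂ w' : V} (r : Φ.RouteData RP D E₁ E₂ w') (hRD : RP ⊆ D) : (r.toV hRD).y = r.y := rfl

/-- `toV` keeps `b`. [folklore] -/
@[simp] theorem RouteData.toV_b {RP D : Set (Site 2)} {E₁ E₂ w' : V} (r : Φ.RouteData RP D E₁ E₂ w') (hRD : RP ⊆ D) : (r.toV hRD).b = r.b := rfl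

/-- **A neighbour over the window but outside the block forces the sphere**: if `x` is over `blk z t_D s_D`, `o ∼ x` is not over it but satisfies the two clip
inequalities (with `s_R ≤ s_D`), then `o` is outside `hexBall z 3` and `x` is over `hexSphere z 3`. [folklore] -/
theorem sh_mem_hexSphere_of_outer (Φ : HexShadow G) {z : Site 2} {tD sR sD : ℕ} (hs : sR ≤ sD) {x o : V} (hx : Φ.sh x ∈ blk z tD sD) (hadj : G.Adj o x)
    (ho : Φ.sh o ∉ blk z tD sD) (hwin : HexShadow.InWin z tD sR (Φ.sh o)) : Φ.sh x ∈ hexSphere z 3 := by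
  have hlip := Φ.lip hadj
  have hx3 : Φ.sh x ∈ hexBall z 3 := hx.1
  have ho3 : Φ.sh o ∉ hexBall z 3 := by
    intro h3
    have h2 := hwin.2
    exact ho ⟨h3, hwin.1, by omega⟩
  rw [mem_hexBall] at hx3 ho3
  rw [mem_hexSphere]
  have htri := triNorm_sub_le₃₄ (Φ.sh o) (Φ.sh x) z
  push_cast at hx3 ho3 ⊢
  omega

/-- **`LocalLinkage` IMPLIES `ShapedLinkage 3`** (take the full lifted block as cleared set; the certified outer neighbours put `E₁, E₂` on the sphere).
So the gen-33 instances (`𝕋 × {0..k}`, `k ≥ 2`) satisfy the new node, and the vertex-set route subsumes the column route. [cite: DuminilCopinSidoraviciusTassion2016, §2.3 (proof of Fact 2)] -/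
theorem shapedLinkage_of_localLinkage (Φ : HexShadow G) (hL : Φ.LocalLinkage) : Φ.ShapedLinkage 3 := by
  intro z tR tD sR sD htRD hsRD hone
  refine ⟨Φ.lift (blk z tD sD), fun x hx => by rw [blkR_three]; rwa [mem_lift] at hx, fun x _ h3 => by rw [mem_lift]; rwa [blkR_three] at h3, ?_⟩
  intro E₁ E₂ w' hT
  have hE₁D : Φ.sh E₁ ∈ blk z tD sD := by have := hT.E₁W; rwa [mem_lift] at this
  have hE₂D : Φ.sh E₂ ∈ blk z tD sD := by have := hT.E₂W; rwa [mem_lift] at this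
  have hE₁R : Φ.sh E₁ ∈ blk z tR sR := by have := hT.E₁R; rwa [blkR_three] at this
  have hE₂R : Φ.sh E₂ ∈ blk z tR sR := by have := hT.E₂R; rwa [blkR_three] at this
  have hw'D : Φ.sh w' ∈ blk z tD sD := by have := hT.w'W; rwa [mem_lift] at this
  obtain ⟨o₁, a₁, a₂, o₂, ho₁E, -, -, hE₂o, ho₁W, ho₂W, ho₁win, -, -, ho₂win, -⟩ := hT.nbrs
  have ho₁D : Φ.sh o₁ ∉ blk z tD sD := fun h => ho₁W (by rw [mem_lift]; exact h)
  have ho₂D : Φ.sh o₂ ∉ blk z tD sD := fun h => ho₂W (by rw [mem_lift]; exact h)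
  have hE₁S : Φ.sh E₁ ∈ hexSphere z 3 := Φ.sh_mem_hexSphere_of_outer hsRD hE₁D ho₁E ho₁D ho₁win
  have hE₂S : Φ.sh E₂ ∈ hexSphere z 3 := Φ.sh_mem_hexSphere_of_outer hsRD hE₂D hE₂o.symm ho₂D ho₂win
  obtain ⟨r₁, r₂, hy, hb⟩ := hL z tR tD sR sD htRD hsRD hone E₁ E₂ w' hT.ne hE₁R hE₁S hE₂R hE₂S hw'D hT.w'z hT.w'E₁ hT.w'E₂
  have hRD : blk z tR sR ⊆ blk z tD sD := blk_mono z htRD hsRD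
  exact ⟨r₁.toV hRD, r₂.toV hRD, hy, hb⟩

end HexShadow

end Summit.CriticalPhenomena.PercolationContinuityZ3.Theorems.Transplant

end
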